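import Literature.Probability.LatticeModels.MedialTraversalArcs
import Literature.Probability.LatticeModels.RandomClusterRegionCrossingBound
import Literature.Topology.PlaneTopology.AnnulusArcs
import HarnessLib

/-!
# Sectors of an annulus cut by an exploration interface: separated open arms (FK version)

Topic `Literature/Probability/LatticeModels` (trunk `StatMech`, family `crit-ising`). The
deterministic core of the Aizenman–Burchard regularity criterion (Duke Math. J. 99 (1999),
App. A, Lemma A.5) for the exploration interface of a planar FK / random-cluster configuration
in a discretised Dobrushin domain `(Ω_δ, a_δ, b_δ)` approximating a Jordan domain `D`
(`D'.Ω = D.carrier`, arbitrary discrete arcs), in the ONE-SIDED form needed without the BK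
inequality (Duminil-Copin–Smirnov, Clay Math. Proc. 15 (2012), §6.1, proof of Thm. 6.1): if the
medial polyline of the interface traverses a shell `D(x; ρ, R)` `2(j + N)` times, then the
configuration `ω` itself contains `j` open arms across a square band of lattice levels around
`x`, lying in pairwise distinct local open clusters of the band, none of which is locally joined
to the wired arc (`fkArms_of_hasTraversals`). Ingredients: the tight arcs of the traversals
(`MedialTraversalArcs`) are pairwise disjoint, so by the three-arcs lemma
(`PlaneTopology.not_three_arcs_touch`) a component of the annulus minus the polygon is the LEFT
sector of at most two traversals, giving `≥ j + N` distinct left sectors; at most `N` of them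
contain a boundary point of `D` in the middle of the annulus
(`card_le_of_separated_frontier_points`, `N = ⌊1/θ⌋₊ + 1` for a modulus `θ` of the boundary
curve); a left sector without such a point carries the chain of left vertices of its stretch of
darts, consecutive ones joined by edges open in `ω` (`left_step_of_untainted`), and no open path
of the band leaves the sector (open edges do not cross the polygon) nor reaches a site of the
wired arc inside the band (such a site is within `2δ` of `∂D`, off the polygon). The
random-cluster estimate consuming this is `rcMeasure_real_regionArmsAvoiding_inter_le`
(`RandomClusterMultiCrossing`).

## References

* M. Aizenman, A. Burchard, *Hölder regularity and dimension bounds for random curves*, Duke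
  Math. J. 99 (1999), Appendix A, Lemma A.5. [AizenmanBurchardDuke1999]
* H. Duminil-Copin, S. Smirnov, *Conformal invariance of lattice models*, Clay Math. Proc. 15
  (2012), §6.1, proof of Thm. 6.1. [DuminilCopinSmirnov2012Clay]
* S. Smirnov, *Critical percolation in the plane*, C. R. Acad. Sci. Paris 333 (2001), §2.
  [Smirnov2001]
-/

noncomputable section

open Set Metric Literature.Probability.Percolation Literature.Topology.PlaneTopology
open scoped unitInterval Pointwise

namespace Literature.Probability.LatticeModels

variable {D : DiscreteDobrushin} {ω : Percolation.BondConfig (Site 2)} {a : MedialVertex}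
  {l : List MedialVertex}

/-! ### The perturbed polygon lies in the domain (arbitrary discrete arcs) -/

/-- **The perturbed polygon lies in the domain**, for an exploration of any discrete Dobrushin
structure on `(D, δ)` (the arcs play no role): dart pieces lie in open inner faces, connectors
in the `1 × 2` rectangles of two inner faces or in an inner face, all inside `D` by the Jordan
curve theorem. (Generalises `Percolation.pertTrace_subset_carrier`.) [cite: Smirnov2001, §2] -/
theorem IsMedialExploration.pertTrace_subset_carrier' {Dm : RandomPlanarGeometry.DobrushinDomain}
    (hΩ : D.Ω = Dm.carrier) (hexp : IsMedialExploration D ω (a :: l)) (hδ : 0 < D.δ) :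
    hexp.pertTrace ⊆ Dm.carrier := by
  obtain ⟨Ω', δ, A', B'⟩ := D
  cases hΩ
  change 0 < δ at hδ
  intro z hz
  rcases hexp.mem_pertTrace_iff.1 hz with ⟨i, hi, hzi⟩ | ⟨i, ⟨hi1, hi⟩, hzi⟩
  · rw [hexp.dartPiece_eq, Set.mem_smul_set_iff_inv_smul_mem₀ hδ.ne'] at hzi
    exact mem_carrier_of_mem_openSq hδ (hexp.isInnerFace hi) (dartSeg_subset_openSq (hexp.isCorner hi) hzi)
  · rcases hexp.connPiece_cases hi1 hi hδ hzi with
      ⟨K, L, hLK, -, -, hcol, hside, -, hshape⟩ | ⟨K, L, hLK, -, -, -, -, hshape, -, -⟩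
    · rcases hside with ⟨h1, h2⟩ | ⟨h1, h2⟩
      · exact mem_carrier_of_vConnShape hδ (hexp.isInnerFace (by omega)) (hexp.isInnerFace hi)
          hLK rfl hcol.symm h1 h2 hshape
      · exact mem_carrier_of_vConnShape hδ (hexp.isInnerFace hi) (hexp.isInnerFace (by omega))
          hLK hcol.symm rfl h2 h1 hshape
    · refine mem_carrier_of_mem_openSq hδ (hexp.isInnerFace hi) fun k => ?_
      obtain ⟨-, ⟨h1, h2⟩, h3⟩ := hshape
      dsimp only at h1 h2 h3 ⊢
      rcases fin_two_cases_of_ne hLK k with rfl | rfl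
      · constructor <;> linarith
      · rcases h3 with h | h <;> rw [h] <;> constructor <;> linarith

/-- The perturbed polygon misses the boundary curve. [cite: Smirnov2001, §2] -/
theorem IsMedialExploration.pertTrace_disjoint_frontier' {Dm : RandomPlanarGeometry.DobrushinDomain}
    (hΩ : D.Ω = Dm.carrier) (hexp : IsMedialExploration D ω (a :: l)) (hδ : 0 < D.δ) :
    Disjoint hexp.pertTrace (frontier Dm.carrier) :=
  Set.disjoint_left.2 fun _ hz hz' =>
    Set.disjoint_left.1 Dm.disjoint_carrier_frontier (hexp.pertTrace_subset_carrier' hΩ hδ hz) hz'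

/-! ### From a discrete boundary site to the boundary curve, off the polygon -/

/-- **From a discrete boundary site to the boundary curve, off the polygon** (arbitrary discrete
arcs): every site `u` of `∂Ω_δ` is joined to a point `z ∈ ∂D` with `dist (z, δu) ≤ 2δ` by a
straight segment missing the perturbed polygon. (Generalises
`Percolation.exists_frontier_near_of_mem_zdBoundary`, same proof.) [cite: Smirnov2001, §2] -/
theorem IsMedialExploration.exists_frontier_near_of_mem_zdBoundary' {Dm : RandomPlanarGeometry.DobrushinDomain}
    (hΩ : D.Ω = Dm.carrier) (hexp : IsMedialExploration D ω (a :: l)) (hδ : 0 < D.δ) {u : Site 2}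
    (hu : u ∈ D.zdBoundary) :
    ∃ z ∈ frontier Dm.carrier, dist z (meshPoint D.δ u) ≤ 2 * D.δ ∧
      ∀ q ∈ segment ℝ (meshPoint D.δ u) z, q ∉ hexp.pertTrace := by
  obtain ⟨Ω', δ, A', B'⟩ := D
  cases hΩ
  change 0 < δ at hδ
  set D' : DiscreteDobrushin := ⟨Dm.carrier, δ, A', B'⟩ with hD'
  change u ∈ D'.zdBoundary at hu
  change ∃ z ∈ frontier Dm.carrier, dist z (meshPoint δ u) ≤ 2 * δ ∧
      ∀ q ∈ segment ℝ (meshPoint δ u) z, q ∉ hexp.pertTrace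
  have hδ' : 0 < D'.δ := hδ
  have huΩ : meshPoint δ u ∈ Dm.carrier :=
    meshDomain_subset_meshVertices _ _ (D'.zdBoundary_subset_meshDomain hu)
  -- frontier point on a segment from `δu` to a point off `Ω`
  have cross : ∀ {q : ℂ}, q ∉ Dm.carrier → ∃ z ∈ segment ℝ (meshPoint δ u) q, z ∈ frontier Dm.carrier := by
    intro q hq
    obtain ⟨z, hz1, hz2⟩ := Dm.inter_frontier_nonempty_of_isPreconnected
      (convex_segment (meshPoint δ u) q).isPreconnected ⟨_, left_mem_segment _ _ _, huΩ⟩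
      ⟨q, right_mem_segment _ _ _, hq⟩
    exact ⟨z, hz1, hz2⟩
  rcases D'.mem_zdBoundary_iff.1 hu with hu' | ⟨y, hadj, -, g, hg, hug, hyg⟩
  · -- `u ∈ meshBoundary`: a lattice neighbour `y` not `Ω_δ`-adjacent
    obtain ⟨huD, y, hzd, hnadj⟩ := mem_meshBoundary_iff.1 hu'
    have hfree : ∀ q ∈ segment ℝ (meshPoint δ u) (meshPoint δ y), q ∉ hexp.pertTrace := by
      intro q hq hqt
      rw [meshPoint_eq_smul, meshPoint_eq_smul, mem_segment_smul_iff hδ.ne'] at hq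
      obtain ⟨i, hi, -, hsrc, -⟩ := hexp.edge_of_mem_edgeTrace hδ' hzd hqt hq
      exact hnadj (adj_of_eq_cornerSource hexp hi.2 hsrc)
    have hdist : dist (meshPoint δ y) (meshPoint δ u) = δ := by
      rw [dist_comm, dist_meshPoint_of_adj hzd, abs_of_pos hδ]
    by_cases hseg : segment ℝ (meshPoint δ u) (meshPoint δ y) ⊆ closure Dm.carrier
    · -- then `δy ∉ Ω` (else `y ∈ Ω_δ`), so `δy ∈ ∂Ω`
      have hyΩ : meshPoint δ y ∉ Dm.carrier := by
        intro hyΩ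
        apply hnadj
        rw [discreteDomainGraph_adj_iff]
        have hmesh : (meshGraph D'.Ω D'.δ).Adj u y := meshGraph_adj_iff.2 ⟨hzd, hseg⟩
        exact ⟨hmesh, huD, mem_meshDomain_of_meshGraph_adj huD hyΩ hmesh⟩
      refine ⟨meshPoint δ y, ⟨hseg (right_mem_segment _ _ _), ?_⟩, hdist.le.trans (by linarith), hfree⟩
      rw [Dm.isOpen.interior_eq]; exact hyΩ
    · obtain ⟨q, hq, hqΩ⟩ := not_subset.1 hseg
      obtain ⟨z, hz, hzfr⟩ := cross (fun h => hqΩ (subset_closure h))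
      have hsub : segment ℝ (meshPoint δ u) z ⊆ segment ℝ (meshPoint δ u) (meshPoint δ y) :=
        (convex_segment _ _).segment_subset (left_mem_segment _ _ _)
          ((convex_segment _ _).segment_subset (left_mem_segment _ _ _) hq hz)
      refine ⟨z, hzfr, ?_, fun p hp => hfree p (hsub hp)⟩
      have hzball : z ∈ closedBall (meshPoint δ u) δ :=
        (convex_closedBall _ _).segment_subset (mem_closedBall.2 (by rw [dist_self]; exact hδ.le))
          (mem_closedBall.2 hdist.le) (hsub (right_mem_segment _ _ _))
      rw [mem_closedBall] at hzball; linarith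
  · -- `u` is a corner of a non-inner face `g`: some point of `g` is off `Ω`
    have huD : u ∈ meshDomain D'.Ω D'.δ := (discreteDomainGraph_adj_iff.1 hadj).2.1
    have hsq : ∃ q ∈ δ • closedSq g, q ∉ Dm.carrier := by
      by_contra hall
      push Not at hall
      apply hg
      -- all corners are mesh vertices, all sides are mesh edges: `g` is inner
      have hvert : ∀ v, IsCorner v g → meshPoint δ v ∈ Dm.carrier := fun v hv =>
        hall _ (by rw [meshPoint_eq_smul]; exact Set.smul_mem_smul_set (toComplex_mem_closedSq hv))
      have hmesh : ∀ v w, IsCorner v g → IsCorner w g → (zdGraph 2).Adj v w →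
          (meshGraph D'.Ω D'.δ).Adj v w := by
        intro v w hv hw hvw
        refine meshGraph_adj_iff.2 ⟨hvw, fun p hp => subset_closure (hall p ?_)⟩
        change p ∈ segment ℝ (meshPoint δ v) (meshPoint δ w) at hp
        rw [meshPoint_eq_smul, meshPoint_eq_smul, ← smul_segment_eq] at hp
        obtain ⟨p', hp', rfl⟩ := hp
        exact Set.smul_mem_smul_set ((convex_closedSq g).segment_subset (toComplex_mem_closedSq hv)
          (toComplex_mem_closedSq hw) hp')
      have hdom : ∀ v, IsCorner v g → v ∈ meshDomain D'.Ω D'.δ := by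
        intro v hv
        rcases Percolation.IsCorner.exists_adj_chain hug hv with rfl | h | ⟨c, hc, h1, h2⟩
        · exact huD
        · exact mem_meshDomain_of_meshGraph_adj huD (hvert v hv) (hmesh _ _ hug hv h)
        · exact mem_meshDomain_of_meshGraph_adj (mem_meshDomain_of_meshGraph_adj huD (hvert c hc) (hmesh _ _ hug hc h1))
            (hvert v hv) (hmesh _ _ hc hv h2)
      intro v w hv hw hvw
      exact discreteDomainGraph_adj_iff.2 ⟨hmesh v w hv hw hvw, hdom v hv, hdom w hw⟩
    obtain ⟨q, hq, hqΩ⟩ := hsq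
    obtain ⟨z, hz, hzfr⟩ := cross hqΩ
    have husq : meshPoint δ u ∈ δ • closedSq g := by
      rw [meshPoint_eq_smul]; exact Set.smul_mem_smul_set (toComplex_mem_closedSq hug)
    have hconv : Convex ℝ (δ • closedSq g) := (convex_closedSq g).smul δ
    have hsub : segment ℝ (meshPoint δ u) z ⊆ δ • closedSq g :=
      hconv.segment_subset husq (hconv.segment_subset husq hq hz)
    refine ⟨z, hzfr, ?_, fun p hp hpt => ?_⟩
    · have := closedSq_subset_closedBall hug ((Set.mem_smul_set_iff_inv_smul_mem₀ hδ.ne' _ _).1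
        (hsub (right_mem_segment _ _ _)))
      rw [mem_closedBall, ← mul_le_mul_iff_right₀ hδ, ← abs_of_pos hδ, ← Real.norm_eq_abs, ← dist_smul₀,
        Real.norm_eq_abs, abs_of_pos hδ, smul_inv_smul₀ hδ.ne', ← meshPoint_eq_smul] at this
      linarith
    · exact hg (hexp.isInnerFace_of_mem_closedSq hδ' hpt
        ((Set.mem_smul_set_iff_inv_smul_mem₀ hδ.ne' _ _).1 (hsub hp)))

/-! ### The touching point of a dart piece and its left sector -/

/-- **The piece of a dart touches the closure of its left sector.** If the closed
`δ`-neighbourhood of the left point `δ·vₘ` of the dart `m` lies in the open set `A`, some point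
of the dart piece of `m` lies in the closure of the connected component of `δ·vₘ` in `A` minus
the perturbed polygon: the first point of the polygon on the side segment from `δ·vₘ` to the
centre of the face of `m` (it lies on the dart piece of `m`, `mem_dartPiece_of_mem_sideSeg`,
and the half-open segment before it is off the polygon). [cite: AizenmanBurchardDuke1999, Appendix A] -/
theorem IsMedialExploration.exists_mem_dartPiece_mem_closure (hexp : IsMedialExploration D ω (a :: l))
    (hδ : 0 < D.δ) {A : Set ℂ} {m : ℕ} (hm : m < ((a :: l).zip l).length)
    (hA : closedBall (hexp.leftPt m) D.δ ⊆ A) :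
    ∃ P ∈ hexp.dartPiece m, P ∈ closure (connectedComponentIn (A \ hexp.pertTrace) (hexp.leftPt m)) := by
  -- the side segment as a path, and the closed set of times on the dart piece
  set sg : Path (hexp.leftPt m) (hexp.rightPt m) := Path.segment _ _ with hsg
  have hsgmem : ∀ u, sg u ∈ hexp.sideSeg m := fun u ↦ by
    rw [IsMedialExploration.sideSeg, ← Path.range_segment]; exact ⟨u, rfl⟩
  have hclosed : IsClosed (hexp.dartPiece m) := by
    rw [IsMedialExploration.dartPiece, ← Path.range_segment]
    exact (isCompact_range (Path.segment _ _).continuous).isClosed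
  set Tm : Set I := {u | sg u ∈ hexp.dartPiece m} with hTm
  have hTmc : IsClosed Tm := hclosed.preimage sg.continuous
  -- it is nonempty: the dart piece crosses the side segment
  have hne : Tm.Nonempty := by
    obtain ⟨w, hw, hw'⟩ := exists_mem_dartSeg_mem_openSegment (hexp.isCorner hm)
    have hwside : D.δ • w ∈ hexp.sideSeg m := by
      rw [hexp.mem_sideSeg_iff hδ, inv_smul_smul₀ hδ.ne']
      exact openSegment_subset_segment ℝ _ _ hw'
    have hwdart : D.δ • w ∈ hexp.dartPiece m := by
      rw [hexp.dartPiece_eq]; exact Set.smul_mem_smul_set hw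
    have : D.δ • w ∈ range sg := by rw [hsg, Path.range_segment]; exact hwside
    obtain ⟨u, hu⟩ := this
    exact ⟨u, by change sg u ∈ hexp.dartPiece m; rw [hu]; exact hwdart⟩
  obtain ⟨u₀, hu₀, hmin⟩ := hTmc.isCompact.exists_isLeast hne
  -- `u₀ > 0`: the left point is off the polygon
  have hu₀pos : 0 < u₀ := by
    rcases eq_or_lt_of_le (unitInterval.nonneg' (t := u₀)) with h | h
    · exfalso
      have h0 : sg u₀ = hexp.leftPt m := by rw [← h]; exact sg.source
      exact hexp.leftPt_not_mem_pertTrace hδ hm (h0 ▸ hexp.dartPiece_subset hm hu₀)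
    · exact h
  refine ⟨sg u₀, hu₀, ?_⟩
  -- the image of `[0, u₀)` is connected, contains the left point, misses the polygon, lies in `A`
  have hsub : sg '' Iio u₀ ⊆ connectedComponentIn (A \ hexp.pertTrace) (hexp.leftPt m) := by
    refine (isPreconnected_Iio.image sg sg.continuous.continuousOn).subset_connectedComponentIn
      ⟨0, hu₀pos, sg.source⟩ ?_
    rintro _ ⟨u, hu, rfl⟩
    refine ⟨hA ((hexp.sideSeg_subset_closedBall hδ hm) (hsgmem u)), fun ht ↦ ?_⟩
    have hud : sg u ∈ hexp.dartPiece m := hexp.mem_dartPiece_of_mem_sideSeg hδ hm ht (hsgmem u)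
    exact absurd (hmin hud) (not_le.2 hu)
  refine closure_mono hsub ?_
  -- `sg u₀` is the limit of `sg u`, `u → u₀⁻`
  have hcont : ContinuousWithinAt sg (Iio u₀) u₀ := sg.continuous.continuousWithinAt
  have hne' : (Iio u₀).Nonempty := ⟨0, hu₀pos⟩
  have hu₀cl : u₀ ∈ closure (Iio u₀) := by rw [closure_Iio' hne']; exact self_mem_Iic
  exact hcont.mem_closure_image hu₀cl

/-! ### Open edges do not cross the polygon -/

/-- **An edge open in the completed configuration does not meet the perturbed polygon** (the
polygon crosses only closed edges, `edge_of_mem_edgeTrace`). [cite: Smirnov2001, §2] -/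
theorem IsMedialExploration.segment_disjoint_pertTrace_of_mem_bc (hexp : IsMedialExploration D ω (a :: l))
    (hδ : 0 < D.δ) {u w : Site 2} (huw : (zdGraph 2).Adj u w) (hbc : s(u, w) ∈ D.bcBondConfig ω) :
    Disjoint (segment ℝ (meshPoint D.δ u) (meshPoint D.δ w)) hexp.pertTrace := by
  refine Set.disjoint_left.2 fun q hq hqt ↦ ?_
  rw [meshPoint_eq_smul, meshPoint_eq_smul, mem_segment_smul_iff hδ.ne'] at hq
  obtain ⟨i, -, -, -, hnot⟩ := hexp.edge_of_mem_edgeTrace hδ huw hqt hq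
  exact hnot hbc

/-! ### The band graph of open edges between two lattice levels -/

/-- **The band graph**: lattice edges open in `ω` AND in the completed configuration of `D`
(`bcBondConfig`: edges of `Ω_δ` without endpoint on the dual-wired arc), both of whose endpoints
have sup-norm level about `x₀` in `[nᵢ, nₒ]`. Its paths are the "local open paths of the band"
of the successive-conditioning argument (DCS 2012, §6.1). [cite: DuminilCopinSmirnov2012Clay, §6.1] -/
def bandGraph (D : DiscreteDobrushin) (ω : Percolation.BondConfig (Site 2)) (x₀ : Site 2) (nᵢ nₒ : ℤ) :
    SimpleGraph (Site 2) :=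
  SimpleGraph.fromRel fun u w ↦ s(u, w) ∈ ω ∧ s(u, w) ∈ D.bcBondConfig ω ∧ (zdGraph 2).Adj u w ∧
    nᵢ ≤ supLevel x₀ u ∧ supLevel x₀ u ≤ nₒ ∧ nᵢ ≤ supLevel x₀ w ∧ supLevel x₀ w ≤ nₒ

/-- Adjacency in the band graph. [folklore] -/
theorem bandGraph_adj {D : DiscreteDobrushin} {ω : Percolation.BondConfig (Site 2)} {x₀ : Site 2} {nᵢ nₒ : ℤ}
    {u w : Site 2} :
    (bandGraph D ω x₀ nᵢ nₒ).Adj u w ↔ s(u, w) ∈ ω ∧ s(u, w) ∈ D.bcBondConfig ω ∧ (zdGraph 2).Adj u w ∧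
      nᵢ ≤ supLevel x₀ u ∧ supLevel x₀ u ≤ nₒ ∧ nᵢ ≤ supLevel x₀ w ∧ supLevel x₀ w ≤ nₒ := by
  rw [bandGraph, SimpleGraph.fromRel_adj]
  constructor
  · rintro ⟨-, h | h⟩
    · exact h
    · rw [Sym2.eq_swap]
      exact ⟨h.1, h.2.1, h.2.2.1.symm, h.2.2.2.2.2.1, h.2.2.2.2.2.2, h.2.2.2.1, h.2.2.2.2.1⟩
  · intro h
    exact ⟨h.2.2.1.ne, Or.inl h⟩

/-- **Band paths stay in one sector.** If every site of level in `[nᵢ, nₒ]` has its closed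
`δ`-neighbourhood inside the open set `A`, two sites joined in the band graph lie in the same
connected component of `A` minus the perturbed polygon (open edges miss the polygon).
[cite: AizenmanBurchardDuke1999, Appendix A] -/
theorem IsMedialExploration.connectedComponentIn_eq_of_bandGraph_reachable (hexp : IsMedialExploration D ω (a :: l))
    (hδ : 0 < D.δ) {A : Set ℂ} {x₀ : Site 2} {nᵢ nₒ : ℤ}
    (hA : ∀ z : Site 2, nᵢ ≤ supLevel x₀ z → supLevel x₀ z ≤ nₒ → closedBall (meshPoint D.δ z) D.δ ⊆ A)
    {u w : Site 2} (h : (bandGraph D ω x₀ nᵢ nₒ).Reachable u w) :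
    connectedComponentIn (A \ hexp.pertTrace) (meshPoint D.δ u) =
      connectedComponentIn (A \ hexp.pertTrace) (meshPoint D.δ w) := by
  obtain ⟨p⟩ := h
  induction p with
  | nil => rfl
  | @cons u' v' w' hadj _ ih =>
    rw [← ih]
    obtain ⟨-, hbc, hzd, h1, h2, -, -⟩ := bandGraph_adj.1 hadj
    -- the open edge `[δu', δv']` lies in `A` (within `δ` of `δu'`) and misses the polygon
    have hseg : segment ℝ (meshPoint D.δ u') (meshPoint D.δ v') ⊆ A \ hexp.pertTrace := by
      intro q hq
      refine ⟨hA u' h1 h2 ((convex_closedBall _ _).segment_subset (mem_closedBall.2 ?_) (mem_closedBall.2 ?_) hq),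
        Set.disjoint_left.1 (hexp.segment_disjoint_pertTrace_of_mem_bc hδ hzd hbc) hq⟩
      · rw [dist_self]; exact hδ.le
      · rw [dist_comm, dist_meshPoint_of_adj hzd, abs_of_pos hδ]
    exact connectedComponentIn_eq ((convex_segment _ _).isPreconnected.subset_connectedComponentIn
      (left_mem_segment _ _ _) hseg (right_mem_segment _ _ _))

/-! ### Untainted left steps are open in `ω` and in the completed configuration -/

/-- **A left step towards a vertex off the wired arc is trivial or along an edge open in `ω`
and in the completed configuration.** [cite: Smirnov2001, §2] -/
theorem IsMedialExploration.left_step_bc (hexp : IsMedialExploration D ω (a :: l)) {i : ℕ} (hi1 : 1 ≤ i)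
    (hi : i < ((a :: l).zip l).length) (hA : hexp.cv i ∉ D.zdArcA) :
    hexp.cv (i - 1) = hexp.cv i ∨
      (s(hexp.cv (i - 1), hexp.cv i) ∈ ω ∧ s(hexp.cv (i - 1), hexp.cv i) ∈ D.bcBondConfig ω ∧
        (zdGraph 2).Adj (hexp.cv (i - 1)) (hexp.cv i)) := by
  rcases hexp.turn_cases hi1 hi with ⟨hv, -⟩ | ⟨-, -, he, hopen⟩
  · exact Or.inl hv
  · right
    have hadj : (zdGraph 2).Adj (hexp.cv (i - 1)) (hexp.cv i) :=
      meshGraph_le_zdGraph _ _ (discreteDomainGraph_le_meshGraph _ _ (IsMedialExploration.adj_of_turn_face he hopen))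
    rw [he] at hopen
    refine ⟨?_, hopen, hadj⟩
    rcases (D.mem_bcBondConfig_iff.1 hopen) with ⟨-, hAA | ⟨hω, -⟩⟩
    · exact absurd (hAA _ (Sym2.mem_mk_right _ _)) hA
    · exact hω

/-! ### The deterministic core: separated open arms from many traversals -/

/-- **Many traversals of a shell by the interface force many separated open arms avoiding the
wired arc** (Aizenman–Burchard 1999, App. A, Lemma A.5, one-sided FK form; DCS 2012, §6.1).
Setting: an exploration interface of `ω` in a discrete Dobrushin structure `D'` on the Jordan
domain `D` (`D'.Ω = D`), mesh `δ`; radii `ρ + 3δ < q₁`, `q₂ + 3δ < R`, `q₁ + ρ + 7δ ≤ r₁`,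
`r₂ + ρ + 7δ ≤ q₂`, `r₁ + 40δ ≤ r₂`, `0 < q₁`; `θ > 0` a modulus of uniform continuity of the
boundary curve at scale `ρ`; lattice levels `nᵢ < nₒ` about a site `x₀` such that the sites of
level in `[nᵢ, nₒ]` are at distance in `[r₁ + 5δ, r₂ - 5δ]` from `x`, the sites within
`r₁ + 4δ` of `x` have level `< nᵢ` and those beyond `r₂ - 4δ` have level `> nₒ`. If the medial
polyline traverses `D(x; ρ, R)` `2(j + ⌊1/θ⌋₊ + 1)` times, there are `j` sites of level `nᵢ`
(left vertices of darts), each joined to a site of level `nₒ` by a path of the band graph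
(lattice edges open in `ω` and in the completed configuration, inside the levels `[nᵢ, nₒ]`),
pairwise not joined by such paths, and none joined by such a path to a site of the wired arc of
level in `(nᵢ, nₒ)`. [cite: AizenmanBurchardDuke1999, Appendix A, Lemma A.5] -/
theorem IsMedialExploration.fkArms_of_hasTraversals {Dm : RandomPlanarGeometry.DobrushinDomain}
    (hΩ : D.Ω = Dm.carrier) (hexp : IsMedialExploration D ω (a :: l)) (hδ : 0 < D.δ)
    {x : ℂ} {ρ R q₁ q₂ r₁ r₂ : ℝ} (hq₁pos : 0 < q₁) (hρ : 0 ≤ ρ)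
    (hq₁ : ρ + 3 * D.δ < q₁) (hq₂ : q₂ + 3 * D.δ < R) (hr₁ : q₁ + ρ + 7 * D.δ ≤ r₁)
    (hr₂ : r₂ + ρ + 7 * D.δ ≤ q₂) (hr : r₁ + 40 * D.δ ≤ r₂)
    {θ : ℝ} (hθ : 0 < θ) (hmod : ∀ s t : ℝ, |s - t| < θ → dist (Dm.boundary s) (Dm.boundary t) < ρ)
    (x₀ : Site 2) {nᵢ nₒ : ℤ} (hnio : nᵢ < nₒ)
    (hband : ∀ z : Site 2, nᵢ ≤ supLevel x₀ z → supLevel x₀ z ≤ nₒ →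
      r₁ + 5 * D.δ ≤ dist (meshPoint D.δ z) x ∧ dist (meshPoint D.δ z) x ≤ r₂ - 5 * D.δ)
    (hin : ∀ z : Site 2, dist (meshPoint D.δ z) x ≤ r₁ + 4 * D.δ → supLevel x₀ z < nᵢ)
    (hout : ∀ z : Site 2, r₂ - 4 * D.δ ≤ dist (meshPoint D.δ z) x → nₒ < supLevel x₀ z)
    {j : ℕ}
    (htr : (⟨polyline ((a :: l).map (medialPoint D.δ))⟩ : RandomPlanarGeometry.Curve ℂ).HasTraversals
      (2 * (j + (⌊1 / θ⌋₊ + 1))) x ρ R) :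
    ∃ s : Finset (Site 2), s.card = j ∧
      (∀ v ∈ s, supLevel x₀ v = nᵢ ∧ (∃ i, i < ((a :: l).zip l).length ∧ v = hexp.cv i) ∧
        ∃ w, supLevel x₀ w = nₒ ∧ (bandGraph D ω x₀ nᵢ nₒ).Reachable v w) ∧
      (∀ v ∈ s, ∀ z ∈ D.zdArcA, nᵢ < supLevel x₀ z → supLevel x₀ z < nₒ →
        ¬ (bandGraph D ω x₀ nᵢ nₒ).Reachable v z) ∧
      (↑s : Set (Site 2)).Pairwise fun v v' ↦ ¬ (bandGraph D ω x₀ nᵢ nₒ).Reachable v v' := by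
  classical
  set N := ⌊1 / θ⌋₊ + 1 with hN
  set k := 2 * (j + N) with hk
  set n := ((a :: l).zip l).length with hn
  set 𝔸 : Set ℂ := {z | q₁ < dist z x ∧ dist z x < q₂} with h𝔸
  set X : Set ℂ := 𝔸 \ hexp.pertTrace with hX
  have hq : q₁ < q₂ := by linarith
  obtain ⟨sT, tT, htrav, hsep⟩ := htr
  /- per-traversal data -/
  choose pl ph E F T m i' j' hpl hplh hph hEd hFd hTsub hTtr hTtight hmT hi'm hmj' hsi' hj't hchain hcends using
    fun q : Fin k ↦ hexp.exists_traversal_arc hδ hq₁ hq₂ (by linarith) (by linarith) hr (htrav q)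
  have hj'n : ∀ q, j' q < n := fun q ↦ (hj't q).trans_lt (hexp.tIdx_lt' (tT q))
  have hmn : ∀ q, m q < n := fun q ↦ (hmj' q).trans_lt (hj'n q)
  -- neighbourhoods of the chain vertices lie in the open annulus
  have hball : ∀ q i, i' q ≤ i → i ≤ j' q → closedBall (meshPoint D.δ (hexp.cv i)) (4 * D.δ) ⊆ 𝔸 := by
    intro q i h1 h2 z hz
    rw [mem_closedBall] at hz
    obtain ⟨hlo, hhi⟩ := hchain q i h1 h2
    constructor
    · linarith [dist_triangle (meshPoint D.δ (hexp.cv i)) z x, dist_comm z (meshPoint D.δ (hexp.cv i))]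
    · linarith [dist_triangle z (meshPoint D.δ (hexp.cv i)) x]
  /- the left sectors -/
  set comp : Fin k → Set ℂ := fun q ↦ connectedComponentIn X (hexp.leftPt (m q)) with hcompdef
  have hcompsub : ∀ q, comp q ⊆ X := fun q ↦ connectedComponentIn_subset _ _
  have hcvcomp : ∀ q i, i' q ≤ i → i ≤ j' q → meshPoint D.δ (hexp.cv i) ∈ comp q := by
    intro q i h1 h2
    exact hexp.cv_mem_connectedComponentIn hδ (hj'n q)
      (fun i' h1' h2' ↦ (closedBall_subset_closedBall (by linarith)).trans (hball q i' h1' h2')) h1 h2 (hi'm q) (hmj' q)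
  have hcompne : ∀ q, (comp q).Nonempty := fun q ↦ ⟨_, hcvcomp q (m q) (hi'm q) (hmj' q)⟩
  -- the touching points
  have htouch : ∀ q, (closure (comp q) ∩ range (T q) ∩ 𝔸).Nonempty := by
    intro q
    have hA : closedBall (hexp.leftPt (m q)) D.δ ⊆ 𝔸 :=
      (closedBall_subset_closedBall (by linarith)).trans (hball q (m q) (hi'm q) (hmj' q))
    obtain ⟨P, hP, hPcl⟩ := hexp.exists_mem_dartPiece_mem_closure hδ (hmn q) hA
    refine ⟨P, ⟨hPcl, hmT q hP⟩, hball q (m q) (hi'm q) (hmj' q) ?_⟩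
    exact (closedBall_subset_closedBall (by linarith)) (hexp.dartPiece_subset_closedBall hδ (hmn q) hP)
  /- the arcs are pairwise disjoint -/
  have hstartpiece : ∀ q z, z ∈ hexp.pieceSet (2 * tIdx l (sT q)) → dist z x < q₁ ∨ q₂ < dist z x := by
    intro q z hz
    rw [hexp.pieceSet_two_mul] at hz
    have h1 := hexp.dartPiece_subset_closedBall hδ (hexp.tIdx_lt' (sT q)) hz
    have h2 := hexp.dist_polyline_cv_le' hδ (sT q)
    rw [mem_closedBall] at h1
    set γs := polyline ((a :: l).map (medialPoint D.δ)) (sT q)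
    have hd : dist z γs ≤ 3 * D.δ := by
      linarith [dist_triangle z (meshPoint D.δ (hexp.cv (tIdx l (sT q)))) γs,
        dist_comm γs (meshPoint D.δ (hexp.cv (tIdx l (sT q))))]
    rcases (htrav q).2 with ⟨hs1, -⟩ | ⟨hs1, -⟩
    · left
      change dist γs x ≤ ρ at hs1
      linarith [dist_triangle z γs x]
    · right
      change R ≤ dist γs x at hs1
      linarith [dist_triangle γs z x, dist_comm γs z]
  have hdisj_lt : ∀ q q', q < q' → Disjoint (range (T q)) (range (T q')) := by
    intro q q' hqq'
    refine Set.disjoint_left.2 fun z hz hz' ↦ ?_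
    obtain ⟨p, hp, hzp⟩ := mem_iUnion₂.1 (hTsub q hz)
    obtain ⟨p', hp', hzp'⟩ := mem_iUnion₂.1 (hTsub q' hz')
    rw [Finset.mem_Icc] at hp hp'
    have hts : tIdx l (tT q) ≤ tIdx l (sT q') := tIdx_mono l (hsep hqq').le
    have hph' := hph q
    have hpl' := hpl q'
    have hvalid : (p' + 1) / 2 < n := by
      have := hph q'; have := hexp.tIdx_lt' (tT q'); omega
    by_cases hfar : p + 2 ≤ p'
    · exact Set.disjoint_left.1 (hexp.pieceSet_disjoint hδ hfar hvalid) hzp hzp'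
    · -- the pieces are consecutive: `p'` is the dart piece of the start of traversal `q'`
      have hp'eq : p' = 2 * tIdx l (sT q') := by omega
      rw [hp'eq] at hzp'
      obtain ⟨h1, h2, -, -⟩ := hTtight q' z hz'
      rcases hstartpiece q' z hzp' with h | h <;> linarith
  have hdisj : ∀ q q', q ≠ q' → Disjoint (range (T q)) (range (T q')) := by
    intro q q' hqq'
    rcases lt_or_gt_of_ne hqq' with h | h
    · exact hdisj_lt q q' h
    · exact (hdisj_lt q' q h).symm
  /- no sector is the left sector of three traversals -/
  have hfib : ∀ a₁ a₂ a₃ : Fin k, a₁ ≠ a₂ → a₂ ≠ a₃ → a₃ ≠ a₁ → comp a₁ = comp a₂ → comp a₂ = comp a₃ → False := by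
    intro a₁ a₂ a₃ h12 h23 h31 e12 e23
    refine not_three_arcs_touch hq₁pos hq T hEd hFd (fun q u ↦ ⟨(hTtight q _ ⟨u, rfl⟩).1, (hTtight q _ ⟨u, rfl⟩).2.1⟩)
      (fun q u hu ↦ (hTtight q _ ⟨u, rfl⟩).2.2.1 hu) (fun q u hu ↦ (hTtight q _ ⟨u, rfl⟩).2.2.2 hu) hdisj
      (S := comp a₁) isPreconnected_connectedComponentIn (fun z hz ↦ (hcompsub a₁ hz).1)
      (fun q ↦ Set.disjoint_left.2 fun z hz hz' ↦ (hcompsub a₁ hz).2 (hTtr q hz')) h12 h23 h31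
      (htouch a₁) ?_ ?_
    · rw [e12]; exact htouch a₂
    · rw [e12, e23]; exact htouch a₃
  /- counting: at least `j + N` distinct sectors -/
  set Fc : Finset (Set ℂ) := Finset.univ.image comp with hFc
  have hcard : k ≤ 2 * Fc.card := by
    have h := Finset.card_le_mul_card_image (Finset.univ : Finset (Fin k)) (f := comp) 2 ?_
    · simpa using h
    intro y hy
    by_contra hgt
    push Not at hgt
    obtain ⟨l₁, hl₁, l₂, hl₂, l₃, hl₃, h12, h13, h23⟩ := Finset.two_lt_card.1 hgt
    simp only [Finset.mem_filter, Finset.mem_univ, true_and] at hl₁ hl₂ hl₃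
    exact hfib l₁ l₂ l₃ h12 h23 (Ne.symm h13) (hl₁.trans hl₂.symm) (hl₂.trans hl₃.symm)
  /- tainted sectors are at most `N` -/
  set tainted : Set ℂ → Prop := fun C ↦ ∃ z ∈ frontier Dm.carrier, z ∈ C ∧ q₁ + ρ ≤ dist z x ∧ dist z x ≤ q₂ - ρ
    with htainted
  have hXeq : (ball x q₂ \ closedBall x q₁) \ hexp.pertTrace = X := by
    ext z
    simp only [hX, h𝔸, mem_sdiff, mem_ball, mem_closedBall, not_le, mem_setOf_eq]
    tauto
  have htaint_card : (Fc.filter fun C ↦ tainted C).card ≤ N := by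
    set TF := Fc.filter fun C ↦ tainted C with hTF
    have hwit : ∀ C : TF, ∃ z ∈ frontier Dm.carrier, z ∈ (C : Set ℂ) ∧ q₁ + ρ ≤ dist z x ∧ dist z x ≤ q₂ - ρ := by
      intro C
      have := (Finset.mem_filter.1 C.2).2
      exact this
    choose zf hzfr hzC hzlo hzhi using hwit
    -- every member of `Fc` is a component of `X`
    have hcompC : ∀ C : TF, ∃ q, comp q = C := fun C ↦ by
      obtain ⟨q, -, hq⟩ := Finset.mem_image.1 (Finset.mem_filter.1 C.2).1
      exact ⟨q, hq⟩
    have hccz : ∀ C : TF, connectedComponentIn X (zf C) = C := by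
      intro C
      obtain ⟨q, hq⟩ := hcompC C
      have hz := hzC C
      rw [← hq] at hz ⊢
      exact (connectedComponentIn_eq hz).symm
    set S : Finset ℂ := Finset.univ.image zf with hS
    have hinj : Function.Injective zf := by
      intro C C' h
      apply Subtype.ext
      have h1 := hccz C; have h2 := hccz C'
      rw [h] at h1
      exact h1.symm.trans h2
    have hScard : S.card = TF.card := by
      rw [hS, Finset.card_image_of_injective _ hinj, Finset.card_univ, Fintype.card_coe]
    rw [← hScard]
    refine card_le_of_separated_frontier_points Dm.toJordanDomain (x := x) (r₁ := q₁) (r₂ := q₂) (η := ρ) hθ hmod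
      (K := hexp.pertTrace) (hexp.pertTrace_disjoint_frontier' hΩ hδ) S (fun z hz ↦ ?_) (fun z hz z' hz' hzz' ↦ ?_)
    · obtain ⟨C, -, rfl⟩ := Finset.mem_image.1 hz
      exact ⟨hzfr C, hzlo C, hzhi C⟩
    · obtain ⟨C, -, rfl⟩ := Finset.mem_image.1 hz
      obtain ⟨C', -, rfl⟩ := Finset.mem_image.1 hz'
      rw [hXeq, hccz, hccz]
      intro h
      apply hzz'
      rw [Subtype.ext h]
  /- untainted distinct sectors: at least `j` -/
  set G : Finset (Set ℂ) := Fc.filter fun C ↦ ¬ tainted C with hG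
  have hjG : j ≤ G.card := by
    have h1 : Fc.card = (Fc.filter fun C ↦ tainted C).card + G.card := by
      rw [hG, Finset.card_filter_add_card_filter_not]
    omega
  obtain ⟨Cs, hCsinj, hCsG⟩ := exists_injective_of_le_card hjG
  have hCs : ∀ i, ∃ q, comp q = Cs i := fun i ↦ by
    obtain ⟨q, -, hq⟩ := Finset.mem_image.1 (Finset.mem_filter.1 (hCsG i)).1
    exact ⟨q, hq⟩
  choose L hL using hCs
  have hLne : ∀ i i', i ≠ i' → comp (L i) ≠ comp (L i') := by
    intro i i' hii' h
    rw [hL, hL] at h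
    exact hii' (hCsinj h)
  have huntaint : ∀ i, ¬ tainted (comp (L i)) := fun i ↦ by
    have := (Finset.mem_filter.1 (hCsG i)).2
    rwa [← hL] at this
  /- in an untainted sector, no chain vertex is on the wired arc -/
  have hsegA : ∀ {c : ℂ} {z : ℂ}, r₁ - 2 * D.δ < dist c x → dist c x < r₂ + 2 * D.δ → dist z c ≤ 2 * D.δ →
      segment ℝ c z ⊆ 𝔸 ∧ q₁ + ρ ≤ dist z x ∧ dist z x ≤ q₂ - ρ := by
    intro c z hlo hhi hzc
    refine ⟨fun w hw ↦ ?_, ?_, ?_⟩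
    · have hw' : dist w c ≤ 2 * D.δ := by
        have := (convex_closedBall c (2 * D.δ)).segment_subset (mem_closedBall.2 (by rw [dist_self]; positivity))
          (mem_closedBall.2 hzc) hw
        rwa [mem_closedBall] at this
      constructor
      · linarith [dist_triangle c w x, dist_comm c w]
      · linarith [dist_triangle w c x]
    · linarith [dist_triangle c z x, dist_comm c z]
    · linarith [dist_triangle z c x]
  have hnotA : ∀ i₀ i, i' (L i₀) ≤ i → i ≤ j' (L i₀) → hexp.cv i ∉ D.zdArcA := by
    intro i₀ i h1 h2 hiA
    apply huntaint i₀
    obtain ⟨z, hzfr, hzd, hfree⟩ := hexp.exists_frontier_near_of_mem_zdBoundary' hΩ hδ (D.zdArcA_subset_zdBoundary hiA)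
    obtain ⟨hlo, hhi⟩ := hchain (L i₀) i h1 h2
    obtain ⟨hsegsub, hz1, hz2⟩ := hsegA hlo hhi hzd
    simp only [htainted]
    refine ⟨z, hzfr, ?_, hz1, hz2⟩
    have hcv := hcvcomp (L i₀) i h1 h2
    change z ∈ connectedComponentIn X (hexp.leftPt (m (L i₀)))
    rw [connectedComponentIn_eq hcv]
    exact (convex_segment _ _).isPreconnected.subset_connectedComponentIn (left_mem_segment _ _ _)
      (fun w hw ↦ (⟨hsegsub hw, hfree w hw⟩ : w ∈ 𝔸 \ hexp.pertTrace)) (right_mem_segment _ _ _)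
  /- the chain graph of a traversal and the arm in the band -/
  have hA𝔸 : ∀ z : Site 2, nᵢ ≤ supLevel x₀ z → supLevel x₀ z ≤ nₒ → closedBall (meshPoint D.δ z) D.δ ⊆ 𝔸 := by
    intro z h1 h2 w hw
    rw [mem_closedBall] at hw
    obtain ⟨hlo, hhi⟩ := hband z h1 h2
    constructor
    · linarith [dist_triangle (meshPoint D.δ z) w x, dist_comm w (meshPoint D.δ z)]
    · linarith [dist_triangle w (meshPoint D.δ z) x]
  have harm : ∀ i₀ : Fin j, ∃ u : Site 2, supLevel x₀ u = nᵢ ∧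
      (∃ i, i' (L i₀) ≤ i ∧ i ≤ j' (L i₀) ∧ u = hexp.cv i) ∧
      ∃ w, supLevel x₀ w = nₒ ∧ (bandGraph D ω x₀ nᵢ nₒ).Reachable u w := by
    intro i₀
    set q := L i₀ with hqdef
    -- the chain graph
    set H : SimpleGraph (Site 2) := SimpleGraph.fromRel fun u w ↦
      ∃ i, i' q < i ∧ i ≤ j' q ∧ u = hexp.cv (i - 1) ∧ w = hexp.cv i with hH
    have hHadj : ∀ {u w}, H.Adj u w → s(u, w) ∈ ω ∧ s(u, w) ∈ D.bcBondConfig ω ∧ (zdGraph 2).Adj u w ∧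
        (∃ i, i' q ≤ i ∧ i ≤ j' q ∧ u = hexp.cv i) := by
      intro u w huw
      rw [hH, SimpleGraph.fromRel_adj] at huw
      obtain ⟨hne, h⟩ := huw
      have key : ∀ {u w}, u ≠ w → (∃ i, i' q < i ∧ i ≤ j' q ∧ u = hexp.cv (i - 1) ∧ w = hexp.cv i) →
          s(u, w) ∈ ω ∧ s(u, w) ∈ D.bcBondConfig ω ∧ (zdGraph 2).Adj u w ∧
          (∃ i, i' q ≤ i ∧ i ≤ j' q ∧ u = hexp.cv i) ∧ (∃ i, i' q ≤ i ∧ i ≤ j' q ∧ w = hexp.cv i) := by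
        rintro u w hne ⟨i, h1, h2, rfl, rfl⟩
        rcases hexp.left_step_bc (i := i) (by omega) ((hj'n q).trans_le' h2) (hnotA i₀ i h1.le h2) with h | ⟨hω, hbc, hadj⟩
        · exact absurd h hne
        · exact ⟨hω, hbc, hadj, ⟨i - 1, by omega, by omega, rfl⟩, ⟨i, h1.le, h2, rfl⟩⟩
      rcases h with h | h
      · obtain ⟨h1, h2, h3, h4, -⟩ := key hne h
        exact ⟨h1, h2, h3, h4⟩
      · obtain ⟨h1, h2, h3, -, h5⟩ := key hne.symm h
        rw [Sym2.eq_swap]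
        exact ⟨h1, h2, h3.symm, h5⟩
    -- the chain is connected in `H`
    have hreach : ∀ d, i' q + d ≤ j' q → H.Reachable (hexp.cv (i' q)) (hexp.cv (i' q + d)) := by
      intro d
      induction d with
      | zero => intro; rfl
      | succ d ih =>
        intro hd
        refine (ih (by omega)).trans ?_
        by_cases heq : hexp.cv (i' q + d) = hexp.cv (i' q + (d + 1))
        · rw [← heq]
        · refine SimpleGraph.Adj.reachable ?_
          rw [hH, SimpleGraph.fromRel_adj]
          exact ⟨heq, Or.inl ⟨i' q + d + 1, by omega, by omega, by rw [Nat.add_sub_cancel], rfl⟩⟩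
    have hreach' : H.Reachable (hexp.cv (i' q)) (hexp.cv (j' q)) := by
      have := hreach (j' q - i' q) (by have := hi'm q; have := hmj' q; omega)
      rwa [show i' q + (j' q - i' q) = j' q by have := hi'm q; have := hmj' q; omega] at this
    have hlip : ∀ ⦃u w : Site 2⦄, H.Adj u w → supLevel x₀ u ≤ supLevel x₀ w + 1 := fun u w huw ↦
      supLevel_le_of_adj x₀ (hHadj huw).2.2.1
    -- the band walk, in either direction of the chain
    have hband_walk : ∃ u v : Site 2, supLevel x₀ u = nᵢ ∧ supLevel x₀ v = nₒ ∧
        (SimpleGraph.fromRel fun s t ↦ H.Adj s t ∧ nᵢ ≤ supLevel x₀ s ∧ supLevel x₀ s ≤ nₒ ∧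
          nᵢ ≤ supLevel x₀ t ∧ supLevel x₀ t ≤ nₒ).Reachable u v := by
      rcases hcends q with ⟨h1, h2⟩ | ⟨h1, h2⟩
      · obtain ⟨u, v, hu, hv, h⟩ := exists_walk_in_band (supLevel x₀) hlip hnio.le (hin _ h1).le (hout _ h2).le hreach'
        exact ⟨u, v, hu, hv, h⟩
      · obtain ⟨u, v, hu, hv, h⟩ := exists_walk_in_band (supLevel x₀) hlip hnio.le (hin _ h2).le (hout _ h1).le hreach'.symm
        exact ⟨u, v, hu, hv, h⟩
    obtain ⟨u, v, hu, hv, huv⟩ := hband_walk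
    -- `u ≠ v`, so `u` has a neighbour in `H`: it is a chain vertex
    have hne : u ≠ v := fun h ↦ by rw [h, hv] at hu; omega
    obtain ⟨pth⟩ := huv
    have hfirst : ∃ w, H.Adj u w := by
      cases pth with
      | nil => exact absurd rfl hne
      | cons h _ => exact ⟨_, ((SimpleGraph.fromRel_adj _ _ _).1 h).2.elim (fun h ↦ h.1) (fun h ↦ h.1.symm)⟩
    obtain ⟨w₀, hw₀⟩ := hfirst
    refine ⟨u, hu, (hHadj hw₀).2.2.2, v, hv, ?_⟩
    -- the band walk of `H` is a band walk of `ω`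
    refine SimpleGraph.Reachable.mono ?_ ⟨pth⟩
    intro s t hst
    rw [SimpleGraph.fromRel_adj] at hst
    rw [bandGraph_adj]
    rcases hst.2 with ⟨h, h1, h2, h3, h4⟩ | ⟨h, h1, h2, h3, h4⟩
    · obtain ⟨hω, hbc, hadj, -⟩ := hHadj h
      exact ⟨hω, hbc, hadj, h1, h2, h3, h4⟩
    · obtain ⟨hω, hbc, hadj, -⟩ := hHadj h
      rw [Sym2.eq_swap]
      exact ⟨hω, hbc, hadj.symm, h3, h4, h1, h2⟩
  choose rep hrepl hrepcv hrepw using harm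
  have hrepcomp : ∀ i₀, meshPoint D.δ (rep i₀) ∈ comp (L i₀) := fun i₀ ↦ by
    obtain ⟨i, h1, h2, h3⟩ := hrepcv i₀
    rw [h3]; exact hcvcomp (L i₀) i h1 h2
  have hccrep : ∀ i₀, connectedComponentIn X (meshPoint D.δ (rep i₀)) = comp (L i₀) := fun i₀ ↦
    (connectedComponentIn_eq (hrepcomp i₀)).symm
  -- band-reachable sites are in the same sector
  have hreach_cc : ∀ {i₀ z}, (bandGraph D ω x₀ nᵢ nₒ).Reachable (rep i₀) z →
      connectedComponentIn X (meshPoint D.δ z) = comp (L i₀) := fun {i₀ z} h ↦ by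
    rw [← hexp.connectedComponentIn_eq_of_bandGraph_reachable hδ hA𝔸 h, hccrep]
  have hrepinj : Function.Injective rep := by
    intro i₀ i₁ h
    by_contra hne
    apply hLne i₀ i₁ hne
    rw [← hccrep, ← hccrep, h]
  refine ⟨Finset.univ.image rep, ?_, ?_, ?_, ?_⟩
  · rw [Finset.card_image_of_injective _ hrepinj, Finset.card_univ, Fintype.card_fin]
  · intro v hv
    obtain ⟨i₀, -, rfl⟩ := Finset.mem_image.1 hv
    obtain ⟨i, h1, h2, h3⟩ := hrepcv i₀
    exact ⟨hrepl i₀, ⟨i, (hj'n (L i₀)).trans_le' h2, h3⟩, hrepw i₀⟩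
  · intro v hv z hzA hz1 hz2 hreach
    obtain ⟨i₀, -, rfl⟩ := Finset.mem_image.1 hv
    apply huntaint i₀
    have hcc := hreach_cc hreach
    -- `δz ∈ X` (its component is the nonempty sector)
    have hzX : meshPoint D.δ z ∈ X := by
      by_contra h
      rw [connectedComponentIn_eq_empty h] at hcc
      exact (hcompne (L i₀)).ne_empty hcc.symm
    obtain ⟨zf, hzfr, hzd, hfree⟩ := hexp.exists_frontier_near_of_mem_zdBoundary' hΩ hδ (D.zdArcA_subset_zdBoundary hzA)
    obtain ⟨hlo, hhi⟩ := hband z hz1.le hz2.le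
    obtain ⟨hsegsub, hzf1, hzf2⟩ := hsegA (c := meshPoint D.δ z) (by linarith) (by linarith) hzd
    simp only [htainted]
    refine ⟨zf, hzfr, ?_, hzf1, hzf2⟩
    rw [← hcc]
    exact (convex_segment _ _).isPreconnected.subset_connectedComponentIn (left_mem_segment _ _ _)
      (fun w hw ↦ (⟨hsegsub hw, hfree w hw⟩ : w ∈ 𝔸 \ hexp.pertTrace)) (right_mem_segment _ _ _)
  · intro v hv v' hv' hvv' hreach
    obtain ⟨i₀, -, rfl⟩ := Finset.mem_image.1 hv
    obtain ⟨i₁, -, rfl⟩ := Finset.mem_image.1 hv'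
    have hne : i₀ ≠ i₁ := fun h ↦ hvv' (by rw [h])
    apply hLne i₀ i₁ hne
    rw [← hreach_cc hreach, hccrep]

end Literature.Probability.LatticeModels

end
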